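import Summits.AnomalousDissipation.AnomalousDissipation.Theorems.SolenoidalFractalHomogenisationLagrangianCarrierConstructionRegularLWindowDistortion
import Summits.AnomalousDissipation.AnomalousDissipation.Theorems.SolenoidalFractalHomogenisationLagrangianCarrierConstructionRegularLLevelBounds
import Summits.AnomalousDissipation.AnomalousDissipation.Theorems.SolenoidalFractalHomogenisationLagrangianCarrierConstructionRegularLLevelC2
import HarnessLib

/-!
# The coarse Lagrangian carrier is Lipschitz with constant `C(k,W)·(a_1 + ⋯ + a_m)` under the strain ceiling and quadratic separation
# (helper for W3-E `stub_effectiveFrameEnergyL` of K1L_D, `--supports stmt-AnomalousDissipation-27980`)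

Summits-side helper file (everything proved; no definitions, no named facts).  For every design `W` there are `θs(k,W) > 0` and
`CL(k,W) ≥ 0` such that for every `LPermissible`, `Regular` Lagrangian lattice carrier `E` with design `W`, quadratic separation
`N_m² ≤ N_{m+1}` and all-levels strain ceiling `θ_{m+1} ≤ θ₀ ≤ θs`: every slice of every partial sum is Lipschitz in the torus metric read
through the centred representative,
  `‖b_{≤m}(t,x) − b_{≤m}(t,y)‖ ≤ CL·(a_1+⋯+a_m)·‖reprc(x − y)‖`   (`lipschitz_partialSum`),
hence `Lip(b_{≤m}(t))·(s′ − s) ≤ 2·CL·θ_{m+1}` on windows of length `≤ 2·refresh(m+1)` (`lipschitz_partialSum_mul_window_le`, from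
`strain m = (Σa)·refresh(m+1) ≤ θ(m+1)`).  Proof: the K3L distortion tower (`distortion_tower`: window distortion `≤ 1/10`, flow curvature
`Γ_m = 3Lθ₀N_m²`) feeds `lipschitzWith_b_succ_of_distortion` level by level; `N_m² ≤ N_{m+1}` and `θ₀ ≤ 1` turn the curvature term
`Γ_m·k·a_{m+1}/(2πN_{m+1})` into `≤ (3Lk/2π)·a_{m+1}`; the torus distance is `≤ ‖reprc(x−y)‖` (`norm_proj_le`, `proj_reprc`).
This is the Lipschitz input (P4d) of the two-weight dissipation floor (crux memo `Lines/onelevel-W3E-k3l-lyapunov.md` §6, F-k3l-6 (a)).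
Infrastructure for route-1's rung leaf F-D1.A0 (a frontier FORMAL rung); NOT a proof of anomalous dissipation.
[cite: ArmstrongVicol2025, §2.2 (PDF p. 18: |∇b_{m}| ≲ Σ a_i) and Cor. 2.4]
-/

set_option linter.dupNamespace false

noncomputable section

namespace Summit.AnomalousDissipation.AnomalousDissipation.Theorems.SolenoidalFractalHomogenisation.LagrangianCarrierConstruction

open Set Function Filter Topology MeasureTheory
open scoped NNReal ContDiff
open Literature.Analysis Literature.Analysis.ODE Literature.Analysis.FunctionSpaces Literature.Analysis.FunctionSpaces.Torus
open Literature.Analysis.FluidPDE Literature.Analysis.FluidPDE.LatticeShear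

variable {k : ℕ}

/-- The torus distance is dominated by the norm of the centred representative of the difference: `dist x y ≤ ‖reprc (x − y)‖`. -/
theorem dist_le_norm_reprc_sub (x y : UnitAddTorus (Fin 3)) : dist x y ≤ ‖reprc (x - y)‖ := by
  rw [dist_eq_norm]
  conv_lhs => rw [← proj_reprc (x - y)]
  exact norm_proj_le _

/-- **Lipschitz bound of the partial sums under the ceiling.** For every design `W` there are `θs > 0`, `CL ≥ 0` with: for every
`LPermissible`, `Regular` carrier of design `W` with `N_m² ≤ N_{m+1}` and `θ_{m+1} ≤ θ₀ ≤ θs` for all `m`,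
`‖b_{≤m}(t,x) − b_{≤m}(t,y)‖ ≤ CL·(a_1+⋯+a_m)·‖reprc(x−y)‖` for all `m, t, x, y`. [cite: ArmstrongVicol2025, Cor. 2.4 (p. 22)] -/
theorem lipschitz_partialSum (k : ℕ) (W : LatticeWord k) : ∃ θs : ℝ, 0 < θs ∧ ∃ CL : ℝ, 0 ≤ CL ∧
    ∀ (E : LagrangianLatticeCarrier k) (θ₀ : ℝ), E.design = W → θ₀ ≤ θs → E.LPermissible → E.Regular →
      (∀ m, E.N m ^ 2 ≤ E.N (m + 1)) → (∀ m, E.θ (m + 1) ≤ θ₀) →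
      ∀ (m : ℕ) (t : ℝ) (x y : UnitAddTorus (Fin 3)),
        ‖E.partialSum m t x - E.partialSum m t y‖ ≤ CL * (∑ i ∈ Finset.range m, E.a (i + 1)) * ‖reprc (x - y)‖ := by
  obtain ⟨L, hL0, hL2W⟩ := exists_levelHessianConst W
  set M : ℝ := Real.sqrt 3 * (3 * (k : ℝ)) with hM
  set U : ℝ := (k : ℝ) / (2 * Real.pi) with hU
  have hM0 : 0 ≤ M := by positivity
  have hU0 : 0 ≤ U := by positivity
  -- the Lipschitz constant per unit amplitude
  set C₀ : ℝ := (1 + 1 / 10) * (3 * L * U + (1 + 1 / 10) * M) with hC₀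
  have hC₀0 : 0 ≤ C₀ := by positivity
  refine ⟨min 1 (min (1 / (60 * M + 1)) (1 / (66 * (L * U) + 1))), lt_min one_pos (lt_min (by positivity) (by positivity)),
    C₀ * holderLiftConst (Fin 3) 1, by positivity, ?_⟩
  intro E θ₀ hD hθs hLP hReg hsq hθ m t x y
  have hP := hLP.permissible
  have hLag := hLP.isLagrangian
  have hLR := hReg.levelRegular
  have hN0 : E.N 0 = 1 := hP.1
  have hN2 : ∀ m, 2 * E.N m ≤ E.N (m + 1) := hP.2.2.1
  have hNpos : ∀ m, (0 : ℝ) < E.N m := fun m => by exact_mod_cast E.toFractalCarrierData.N_pos m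
  have hθ0 : 0 < θ₀ := (E.θ_pos 1).trans_le (hθ 0)
  have hθ1 : θ₀ ≤ 1 := hθs.trans (min_le_left _ _)
  have hθM : 60 * (M * θ₀) ≤ 1 := by
    have h : θ₀ ≤ 1 / (60 * M + 1) := hθs.trans ((min_le_right _ _).trans (min_le_left _ _))
    rw [le_div_iff₀ (by positivity)] at h
    nlinarith
  have hθL : 66 * (L * U * θ₀) ≤ 1 := by
    have h : θ₀ ≤ 1 / (66 * (L * U) + 1) := hθs.trans ((min_le_right _ _).trans (min_le_right _ _))
    rw [le_div_iff₀ (by positivity)] at h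
    nlinarith [mul_nonneg hL0 hU0]
  have tower := distortion_tower E θ₀ hLag hLR.continuous_uncurry_b hLR.isSmooth_b hLR.exists_norm_iteratedFDeriv_b_le
    hLR.continuous_disp hLR.isSmooth_disp hLP.refresh_nested hLP.strain_le hθ hN0 hN2 hsq hL0 (hL2W E.toFractalCarrierData hD)
    hθ1 hθM hθL
  -- each level `b (i+1) t` is Lipschitz with constant `≤ C₀ · a (i+1) · holderLiftConst`
  have hlev : ∀ (i : ℕ) (x y : UnitAddTorus (Fin 3)),
      ‖E.b (i + 1) t x - E.b (i + 1) t y‖ ≤ C₀ * holderLiftConst (Fin 3) 1 * E.a (i + 1) * dist x y := by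
    intro i x y
    have hΓ0 : 0 ≤ 3 * L * θ₀ * (E.N i : ℝ) ^ 2 := by positivity
    have hLip := lipschitzWith_b_succ_of_distortion E i hLag hLR.continuous_uncurry_b hLR.isSmooth_b
      hLR.exists_norm_iteratedFDeriv_b_le hLR.continuous_disp hLR.isSmooth_disp (δ := 1 / 10) (Γ := 3 * L * θ₀ * (E.N i : ℝ) ^ 2) hΓ0
      (fun j s t' hs ht' z => (tower i j s t' hs ht').2.1 z)
      (fun j t' ht' z z' => (tower i j _ t' (left_mem_window E (i + 1) j) ht').2.2 z z') t
    have h1 := hLip.dist_le_mul x y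
    rw [dist_eq_norm] at h1
    refine h1.trans ?_
    have ha : 0 < E.a (i + 1) := E.toFractalCarrierData.a_pos (i + 1)
    -- the NNReal constant is at most `C₀ · a · holderLiftConst`
    have hX : (1 + 1 / 10) * (3 * L * θ₀ * (E.N i : ℝ) ^ 2 * (k * E.a (i + 1) / (2 * Real.pi * E.N (i + 1))) +
        (1 + 1 / 10) * (Real.sqrt 3 * (3 * (k * E.a (i + 1))))) ≤ C₀ * E.a (i + 1) := by
      have hsq' : ((E.N i : ℝ)) ^ 2 ≤ E.N (i + 1) := by exact_mod_cast hsq i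
      have hcurv : 3 * L * θ₀ * (E.N i : ℝ) ^ 2 * (k * E.a (i + 1) / (2 * Real.pi * E.N (i + 1))) ≤ 3 * L * U * E.a (i + 1) := by
        rw [hU]
        have hNi1 := hNpos (i + 1)
        rw [show 3 * L * θ₀ * (E.N i : ℝ) ^ 2 * (k * E.a (i + 1) / (2 * Real.pi * E.N (i + 1))) =
          3 * L * (k / (2 * Real.pi)) * E.a (i + 1) * (θ₀ * ((E.N i : ℝ) ^ 2 / E.N (i + 1))) by
            field_simp]
        have hρ : (E.N i : ℝ) ^ 2 / E.N (i + 1) ≤ 1 := (div_le_one hNi1).2 hsq'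
        have hρ0 : 0 ≤ (E.N i : ℝ) ^ 2 / E.N (i + 1) := by positivity
        have : θ₀ * ((E.N i : ℝ) ^ 2 / E.N (i + 1)) ≤ 1 := by nlinarith
        have h3 : 0 ≤ 3 * L * (k / (2 * Real.pi)) * E.a (i + 1) := by positivity
        nlinarith
      rw [hC₀, hM]
      nlinarith [hcurv, ha.le, hM0]
    have hXnn : 0 ≤ (1 + 1 / 10) * (3 * L * θ₀ * (E.N i : ℝ) ^ 2 * (k * E.a (i + 1) / (2 * Real.pi * E.N (i + 1))) +
        (1 + 1 / 10) * (Real.sqrt 3 * (3 * (k * E.a (i + 1))))) := by positivity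
    have hcoe : ((Real.toNNReal ((1 + 1 / 10) * (3 * L * θ₀ * (E.N i : ℝ) ^ 2 * (k * E.a (i + 1) / (2 * Real.pi * E.N (i + 1))) +
        (1 + 1 / 10) * (Real.sqrt 3 * (3 * (k * E.a (i + 1)))))) * holderLiftConst (Fin 3) 1 : ℝ≥0) : ℝ) ≤
        C₀ * holderLiftConst (Fin 3) 1 * E.a (i + 1) := by
      rw [NNReal.coe_mul, Real.coe_toNNReal _ hXnn]
      have hh : 0 ≤ (holderLiftConst (Fin 3) 1 : ℝ) := NNReal.coe_nonneg _
      nlinarith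
    exact mul_le_mul_of_nonneg_right hcoe dist_nonneg
  -- sum over the levels
  have hsum : ‖E.partialSum m t x - E.partialSum m t y‖ ≤
      ∑ i ∈ Finset.range m, C₀ * holderLiftConst (Fin 3) 1 * E.a (i + 1) * dist x y := by
    simp only [LagrangianLatticeCarrier.partialSum]
    rw [← Finset.sum_sub_distrib]
    exact (norm_sum_le _ _).trans (Finset.sum_le_sum fun i _ => hlev i x y)
  refine hsum.trans ?_
  rw [← Finset.sum_mul, ← Finset.mul_sum]
  have hS : 0 ≤ C₀ * holderLiftConst (Fin 3) 1 * ∑ i ∈ Finset.range m, E.a (i + 1) :=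
    mul_nonneg (by positivity) (Finset.sum_nonneg fun i _ => (E.toFractalCarrierData.a_pos _).le)
  exact mul_le_mul_of_nonneg_left (dist_le_norm_reprc_sub x y) hS

/-- **Strain form**: under the same hypotheses, on every window of length `s′ − s ≤ 2·refresh(m+1)` the Lipschitz constant times the
window length is `≤ 2·CL·θ_{m+1}` (`strain m ≤ θ(m+1)`). [cite: ArmstrongVicol2025, §2.2 (PDF p. 12)] -/
theorem lipschitz_partialSum_mul_window_le (k : ℕ) (W : LatticeWord k) : ∃ θs : ℝ, 0 < θs ∧ ∃ CL : ℝ, 0 ≤ CL ∧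
    ∀ (E : LagrangianLatticeCarrier k) (θ₀ : ℝ), E.design = W → θ₀ ≤ θs → E.LPermissible → E.Regular →
      (∀ m, E.N m ^ 2 ≤ E.N (m + 1)) → (∀ m, E.θ (m + 1) ≤ θ₀) →
      ∀ (m : ℕ), (∀ (t : ℝ) (x y : UnitAddTorus (Fin 3)),
        ‖E.partialSum m t x - E.partialSum m t y‖ ≤ CL * (∑ i ∈ Finset.range m, E.a (i + 1)) * ‖reprc (x - y)‖) ∧
        ∀ s s' : ℝ, s' - s ≤ 2 * E.refresh (m + 1) →
          CL * (∑ i ∈ Finset.range m, E.a (i + 1)) * (s' - s) ≤ 2 * CL * E.θ (m + 1) := by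
  obtain ⟨θs, hθs, CL, hCL, h⟩ := lipschitz_partialSum k W
  refine ⟨θs, hθs, CL, hCL, fun E θ₀ hD hθ hLP hReg hsq hθ' m => ⟨h E θ₀ hD hθ hLP hReg hsq hθ' m, fun s s' hlen => ?_⟩⟩
  have hS0 : 0 ≤ ∑ i ∈ Finset.range m, E.a (i + 1) := Finset.sum_nonneg fun i _ => (E.toFractalCarrierData.a_pos _).le
  have hstrain : (∑ i ∈ Finset.range m, E.a (i + 1)) * E.refresh (m + 1) ≤ E.θ (m + 1) := hLP.strain_le m
  calc CL * (∑ i ∈ Finset.range m, E.a (i + 1)) * (s' - s) ≤ CL * (∑ i ∈ Finset.range m, E.a (i + 1)) * (2 * E.refresh (m + 1)) :=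
        mul_le_mul_of_nonneg_left hlen (mul_nonneg hCL hS0)
    _ = 2 * CL * ((∑ i ∈ Finset.range m, E.a (i + 1)) * E.refresh (m + 1)) := by ring
    _ ≤ 2 * CL * E.θ (m + 1) := mul_le_mul_of_nonneg_left hstrain (by positivity)

end Summit.AnomalousDissipation.AnomalousDissipation.Theorems.SolenoidalFractalHomogenisation.LagrangianCarrierConstruction

end
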